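import Summits.QuantumFields.YangMills.Theorems.BalabanUVNodesN11TransportFineGaugeOrbitAverage
import Summits.QuantumFields.YangMills.Theorems.BalabanUVNodesN11BlockCombCard
import Literature.MathematicalPhysics.QuantumFieldTheory.Balaban1983to89.B14Sect3Decomp

/-!
# DAG node N11 — THE UNIFORM FINE-GAUGE ORBIT AVERAGE OF (3.3)'s SMALL-FIELD FACTOR `χ′_k` IS VOLUME-SUPPRESSED:
# `[χ′_k(X)]^{av}(U,V) ≤ Haar{|h − 1| < 2δ_k}^{#T}` at EVERY `(U,V)`, `T` any centre-avoiding tree of bonds read by `X` (one block comb: `#T = L^d − 1`)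

HEADER — WORK-UNIT METADATA.  Cell `pub-ymgap`, YM-PLAN Track A (HUMAN RULING D-0062), R134 fan-out seat `pub-ymgap-dag-n11-e` (g32) on node N11 [B14]; route
`BalabanUVNodes`, key K1⁹ = stmt-QuantumFields-27364 (helper, `--kind proof --supports 27364 --as helper`, count-neutral).  [I] = [Balaban1987RG1] (CMP 109),
[III] = [Balaban1988Convergent] (CMP 119).  Over, BY NAME and unmodified: this seat's g31 `…N11TransportFineGaugeOrbitAverage` (the ORBIT-AVERAGE LAW of def-T's (†):
`∫dU δ(ŪV⁻¹)[f·ρ] =ᵐ ∫dU δ(ŪV⁻¹)[f^{av}·ρ]`, generic ∕ family editions; `measurable_gaugeAct_fineTransf`), g28 `…N11TreeGaugeRooted` ∕ `…N11TransportBlockCombGauge` ∕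
`…N11BlockCombCard` (centre-avoiding peeling orders `TreeOrder T v r`, the block combs, their cardinality `L^d − 1`), gen 15∕16 `T4AxialGaugeFixing` (`TreeOrder`,
`TreeOrder.fresh_of_max`, `combBonds`), pv28 `B12FaddeevPopov016` (`fineTransf`, `FPIdx`), r11 `B14Sect3Decomp` (`chiPrime`, `SmallApproxFluct`, `Vbox`), Mathlib's `lmarginal`.

WHY (the quantitative face of this seat's LOCATED-FP reading, g31 evidence #48∕#52 on K1⁹).  g31 showed that def-T's one-step transport (†) — whose integrand carries the step
weight `w(s′)(U,V′) ∋ χ′_k` but NOT (1.5)'s Faddeev–Popov factor — reads a non-invariant factor only through its UNIFORM average over the fine gauge group `u(emb y) = 1`, and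
that (3.3)'s `χ′_k` (`|V_k(b)(V^{(k)}_□(V′)(b))⁻¹ − 1| < 2δ_k` bondwise against a background that does not co-move) is such a factor; TERMS of (†) differ from print's, SUMS agree.
THIS FILE says BY HOW MUCH at the small-field term: the uniform orbit average of `χ′_k(X)` is at most `v(2δ_k)^{#T}`, `v(r) := Haar{h : |h − 1| < r}`, for EVERY fine field `U`,
EVERY coarse field `V` and EVERY bond set `T` carrying a peeling order whose fresh ends avoid the block centres and whose bonds are read by cubes of `X` — along the fine gauge
orbit each fresh end is an independent Haar variable, and the bond ratio at a fresh end is a bi-translate (or inverse bi-translate) of it, so each bond of `T` costs a factor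
`v(2δ_k)` exactly (iterated one-site peeling, §1–§2).  The comb of ONE block inside a cube of `X` already gives `#T = L^d − 1` (g28 `card_blockComb`), the block-comb forest of
`|Y|` blocks gives `|Y|·(L^d − 1)`: the weight (†) assigns to its ALL-SMALL-FIELD term (`Q_{k+1} = ∅`, `χ′_k` on every cube) is suppressed EXPONENTIALLY IN THE VOLUME, at every
field, smooth or rough (§3); by g31's law the term itself is then dominated a.e. by that number times the transport of the old density (sibling file).  In print the term
is read AFTER (1.5)⇒(1.6) ([III] p.265 L.8–12), where the fine field sits within `ε_k` of the block axial gauge and `χ′_k` constrains the fluctuation field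
`V_k(V^{(k)}_□)⁻¹` — print's LEADING term ([I] (0.19)–(0.25), [III] (3.10)ff).  So the option «(†) as is, the supplier absorbs (1.5)» left open in g31's repair census
does not reproduce print's terms even in size.  Recorded for the TYPE OWNER (node00-def-T) and the K-lanes; nothing landed is edited; (R1)∕(R2)∕(R3) is theirs to rule.

WHAT THIS FILE PROVES (0 `def`, 0 `sorry`, standard axioms; `v(r)` is written `HaarData.haar {h | dist1 h < r}` throughout).
§1 ONE-SITE HAAR PEELING (any `GaugeGroup` with Haar data, any finite index type): `haar_map_mul_left_mul_right` · `haar_map_mul_inv_mul` (bi-translates and inverse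
   bi-translates push Haar to Haar) · ★ `lintegral_pi_mul_indicator_peel` (`∫∏dg Φ(g)·𝟙_S(ψ(g)) = v(S)·∫∏dg Φ(g)` when `Φ` ignores the coordinate `i₀` and `ψ`, as a function
   of that coordinate with the others frozen, pushes Haar to Haar).
§2 THE FINE GAUGE ORBIT OF A BOND RATIO: `fineTransf_update_of_ne` · `fineTransf_update_self` · `measurable_bondRatio_fineTransf` · ★★ `lintegral_prod_bondIndicator_eq_pow`
   (`∫∏dg ∏_{b∈T} 𝟙{|U^{u_g}(b)·W(b)⁻¹ − 1| < r} = v(r)^{#T}` EXACTLY, for every `U`, every reference field `W`, every centre-avoiding `TreeOrder`) · block-comb editions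
   ★★ `lintegral_prod_bondIndicator_blockComb_eq_pow` (`= v(r)^{L^d − 1}`) · `…_blockCombs_eq_pow` (`= v(r)^{|Y|(L^d − 1)}`).
§3 (3.3) UNDER THE UNIFORM ORBIT AVERAGE (r11's `Sect3Data`, any averaging, any background map): `chiPrime_nonneg` · `chiPrime_le_one` · `chiPrime_le_toReal_prod_bondIndicator`
   (pointwise domination by the bond indicators of ANY `T` read by `X`) · ★★★ `integral_chiPrime_fineOrbit_le_pow` (`[χ′_k(X)(·,V)]^{av}(U) ≤ v(2δ)^{#T}`) ·
   ★★★ `abs_integral_chiPrime_mul_fineOrbit_le` (with ANY co-factor `|w̃| ≤ C`: `|[χ′_k(X)·w̃]^{av}(U)| ≤ C·v(2δ)^{#T}`) · ★★★ `integral_chiPrime_fineOrbit_le_pow_blockComb`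
   (one block comb inside a cube of `X`: `≤ v(2δ)^{L^d − 1}`).
The consequences UNDER (†) (`|∫dU δ(ŪV⁻¹)[χ′_k(X)·w̃·ρ](V)| ≤ C·v(2δ)^{#T}·∫dU δ(ŪV⁻¹)[ρ](V)` a.e., by g31's orbit-average law), the record editions and the
SU(2) numeral (`v(2δ) ≤ π²(2δ)³∕12`, dag-n08-w3's `haar_dist1_lt_le`) are the sibling file `…N11ChiPrimeFineOrbitAverageBoundTransport`.

HONEST FRAMING.  Helper lane of K1⁹, count-neutral; [folklore] measure theory (Haar invariance, Fubini∕iterated marginals) and finite combinatorics composed BY NAME with landed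
bookkeeping; an UPPER BOUND on a quantity of def-T's typed objects — nothing of Bałaban's ESTIMATES asserted, no identity of print asserted or refuted; (O3′) ∕ Thm 1 ∕ Thm 2 NOT
touched; N11 NOT discharged; K1⁹ NOT closed; counts unmoved (typed 28∕28 · discharged 6∕28).  One finite four-torus programme at fixed `ε = L^{−K}` — NOT ℝ⁴, NOT OS, NOT a mass
gap, NOT Clay.  No `sorry`, `axiom`, `def`, `instance`, `notation`.  Sources (SHAPE ∕ bookkeeping only): [III] (1.5)–(1.6) p.247, (3.1) p.264, (3.3)–(3.4) p.265 with L.8–12,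
(3.10) p.266; [I] (0.13)–(0.16) pp.254–255, (0.19)–(0.25) pp.255–257; [Balaban1985Averaging] (8)–(12) p.19.
-/

noncomputable section
open MeasureTheory Function
open scoped ENNReal BigOperators

namespace Summit.QuantumFields.YangMills.Theorems.BalabanUVNodesN11ChiPrimeFineOrbitAverageBound

open Literature.MathematicalPhysics.QuantumFieldTheory.Balaban1983to89
open GaugeField (gaugeAct)
open T4AxialGaugeFixing (TreeOrder combBonds)
open B12FaddeevPopov016 (FineGauge FineGaugeInvariant FPIdx fineTransf)
open BalabanUVNodesN11TransportFineGaugeOrbitAverage (measurable_gaugeAct_fineTransf)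
open BalabanUVNodesN11TransportBlockCombGauge (exists_treeOrder_blockComb_avoiding_emb exists_treeOrder_blockCombs_avoiding_emb)
open BalabanUVNodesN11BlockCombCard (card_blockComb card_blockCombs)

/-! ## §1  One-site Haar peeling on a finite product of copies of the gauge group -/

section Peel

variable {G : Type*} [GaugeGroup G] [MeasurableSpace G] [HaarData G]

/-- A two-sided translate `k ↦ a·k·b` pushes the Haar datum to itself. [folklore] -/
theorem haar_map_mul_left_mul_right [MeasurableMul G] (a b : G) :
    (HaarData.haar : Measure G).map (fun k => a * k * b) = HaarData.haar := by
  have e : (fun k : G => a * k * b) = (fun k => k * b) ∘ (fun k => a * k) := rfl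
  rw [e, ← Measure.map_map (measurable_mul_const b) (measurable_const_mul a), HaarData.map_mul_left, HaarData.map_mul_right]

/-- An inverse two-sided translate `k ↦ a·k⁻¹·b` pushes the Haar datum to itself (inversion invariance of the datum). [folklore] -/
theorem haar_map_mul_inv_mul [MeasurableMul G] [MeasurableInv G] (a b : G) :
    (HaarData.haar : Measure G).map (fun k => a * k⁻¹ * b) = HaarData.haar := by
  have e : (fun k : G => a * k⁻¹ * b) = (fun k => a * k * b) ∘ (fun k : G => k⁻¹) := rfl
  rw [e, ← Measure.map_map ((measurable_const_mul a).mul_const b) measurable_inv, HaarData.map_inv, haar_map_mul_left_mul_right]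

/-- ★ **ONE-SITE HAAR PEELING.**  On the product of copies of `G` over a finite index type, if `Φ ≥ 0` ignores the coordinate `i₀` and `ψ`, as a function of that coordinate with
the others frozen, pushes Haar measure to Haar measure, then `∫∏dg Φ(g)·𝟙_S(ψ(g)) = Haar(S)·∫∏dg Φ(g)`: the `i₀`-integral is innermost (Mathlib's `lmarginal`) and sees only
`𝟙_S` of a Haar-distributed variable. [folklore] -/
theorem lintegral_pi_mul_indicator_peel {ι : Type*} [Fintype ι] [DecidableEq ι] (i₀ : ι)
    {Φ : (ι → G) → ℝ≥0∞} (hΦm : Measurable Φ) (hΦ : ∀ g k, Φ (update g i₀ k) = Φ g)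
    {ψ : (ι → G) → G} (hψm : Measurable ψ) (hψ : ∀ g, (HaarData.haar : Measure G).map (fun k => ψ (update g i₀ k)) = HaarData.haar)
    {S : Set G} (hS : MeasurableSet S) :
    ∫⁻ g, Φ g * S.indicator 1 (ψ g) ∂Measure.pi (fun _ : ι => (HaarData.haar : Measure G)) =
      (HaarData.haar : Measure G) S * ∫⁻ g, Φ g ∂Measure.pi (fun _ : ι => (HaarData.haar : Measure G)) := by
  haveI : IsProbabilityMeasure (HaarData.haar : Measure G) := HaarData.isProb
  have hind : Measurable fun g : ι → G => S.indicator (1 : G → ℝ≥0∞) (ψ g) := (measurable_one.indicator hS).comp hψm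
  rw [← lintegral_const_mul _ hΦm]
  refine lintegral_eq_of_lmarginal_eq {i₀} (hΦm.mul hind) (measurable_const.mul hΦm) ?_
  rw [lmarginal_singleton, lmarginal_singleton]
  funext g
  have hm : Measurable fun k : G => ψ (update g i₀ k) := hψm.comp (measurable_update g)
  have h2 : ∫⁻ k, S.indicator (1 : G → ℝ≥0∞) (ψ (update g i₀ k)) ∂(HaarData.haar : Measure G) = (HaarData.haar : Measure G) S := by
    have h := lintegral_map (μ := (HaarData.haar : Measure G)) (measurable_one.indicator hS) hm
    rw [hψ g, lintegral_indicator_one hS] at h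
    exact h.symm
  have hm2 : Measurable fun k : G => S.indicator (1 : G → ℝ≥0∞) (ψ (update g i₀ k)) := (measurable_one.indicator hS).comp hm
  simp only [hΦ]
  rw [lintegral_const_mul _ hm2, h2, lintegral_const, measure_univ, mul_one, mul_comm]

end Peel

/-! ## §2  The fine gauge orbit of a bond ratio: every centre-avoiding tree of bonds costs `Haar{|h − 1| < r}` per bond, exactly -/

section Bonds

variable {P : Params} {j : ℕ} {G : Type*} [GaugeGroup G] [MeasurableSpace G] [HaarData G] [RegularGaugeGroup G]

omit [MeasurableSpace G] [HaarData G] [RegularGaugeGroup G] in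
/-- Updating the family `g` at the index of a non-centre site `x` does not move `fineTransf g` at any other site. [folklore] -/
theorem fineTransf_update_of_ne (g : FPIdx P j → G) (i₀ : FPIdx P j) (k : G) {z : Site P j} (hz : z ≠ (i₀.2 : Site P j)) :
    fineTransf (update g i₀ k) z = fineTransf g z := by
  unfold fineTransf
  by_cases h : z ∈ (block (blockOf z)).erase (emb (blockOf z))
  · rw [dif_pos h, dif_pos h, update_of_ne]
    intro heq
    exact hz (congrArg (fun i : FPIdx P j => (i.2 : Site P j)) heq)
  · rw [dif_neg h, dif_neg h]

omit [MeasurableSpace G] [HaarData G] [RegularGaugeGroup G] in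
/-- Updating the family `g` at the index of a non-centre site `x` sets `fineTransf g` at `x` to the new value. [folklore] -/
theorem fineTransf_update_self (g : FPIdx P j → G) {x : Site P j} (hx : x ∈ (block (blockOf x)).erase (emb (blockOf x))) (k : G) :
    fineTransf (update g ⟨blockOf x, ⟨x, hx⟩⟩ k) x = k := by
  unfold fineTransf
  rw [dif_pos hx, update_self]

omit [HaarData G] in
/-- The bond ratio `g ↦ U^{u_g}(b)·W(b)⁻¹` is measurable along the fine gauge group. [folklore] -/
theorem measurable_bondRatio_fineTransf (U : GaugeField P j G) (W : PBond P j → G) (b : PBond P j) :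
    Measurable fun g : FPIdx P j → G => gaugeAct (fineTransf g) U b * (W b)⁻¹ :=
  ((measurable_pi_apply b).comp (measurable_gaugeAct_fineTransf.comp (measurable_const.prodMk measurable_id))).mul_const _

omit [HaarData G] in
/-- The small-ratio indicator `g ↦ 𝟙{|U^{u_g}(b)·W(b)⁻¹ − 1| < r}` is measurable along the fine gauge group. [folklore] -/
theorem measurable_bondIndicator_fineTransf (U : GaugeField P j G) (W : PBond P j → G) (b : PBond P j) (r : ℝ) :
    Measurable fun g : FPIdx P j → G => {h : G | dist1 h < r}.indicator (1 : G → ℝ≥0∞) (gaugeAct (fineTransf g) U b * (W b)⁻¹) :=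
  (measurable_one.indicator (measurableSet_lt RegularGaugeGroup.measurable_dist1 measurable_const)).comp (measurable_bondRatio_fineTransf U W b)

/-- A site that is no block centre is a non-centre site of its own block (the index set `FPIdx` of the fine gauge group). [folklore] -/
private theorem mem_erase_of_forall_ne_emb {x : Site P j} (hx : ∀ y : Site P (j + 1), x ≠ emb y) :
    x ∈ (block (blockOf x)).erase (emb (blockOf x)) :=
  Finset.mem_erase.2 ⟨hx (blockOf x), Finset.mem_filter.2 ⟨Finset.mem_univ _, rfl⟩⟩

variable [DecidableEq (PBond P j)]

/-- ★★ **EVERY CENTRE-AVOIDING TREE OF BONDS COSTS `Haar{|h − 1| < r}` PER BOND ALONG THE FINE GAUGE ORBIT — EXACTLY.**  For a bond set `T` with a peeling order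
`TreeOrder T v r` whose fresh ends are never block centres, EVERY fine field `U`, EVERY reference field `W` and every radius `r`:
`∫∏_{(y,x)}dg ∏_{b∈T} 𝟙{|U^{u_g}(b)·W(b)⁻¹ − 1| < r} = (Haar{h : |h − 1| < r})^{#T}`.  Induction on the peeling order (gen 16's step): the bond `b₀` whose fresh end `x` has maximal
rank is the only bond of `T` touching `x`; with the other variables frozen, `g(x) ↦ U^{u_g}(b₀)·W(b₀)⁻¹` is a two-sided translate of `g(x)` (fresh end = source) or of `g(x)⁻¹`
(fresh end = target), so it is Haar distributed and §1 peels the factor `Haar{|h − 1| < r}` off. [cite: Balaban1987RG1, (0.13)–(0.16) pp.254–255 (bookkeeping: the fine gauge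
group and its product Haar measure)] -/
theorem lintegral_prod_bondIndicator_eq_pow {T : Finset (PBond P j)} {v : PBond P j → Site P j} {r : Site P j → ℕ}
    (hT : TreeOrder T v r) (hv : ∀ b ∈ T, ∀ y : Site P (j + 1), v b ≠ emb y) (U : GaugeField P j G) (W : PBond P j → G) (δ : ℝ) :
    ∫⁻ g, ∏ b ∈ T, {h : G | dist1 h < δ}.indicator (1 : G → ℝ≥0∞) (gaugeAct (fineTransf g) U b * (W b)⁻¹)
        ∂Measure.pi (fun _ : FPIdx P j => (HaarData.haar : Measure G)) =
      (HaarData.haar : Measure G) {h : G | dist1 h < δ} ^ T.card := by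
  haveI : IsProbabilityMeasure (HaarData.haar : Measure G) := HaarData.isProb
  have hS : MeasurableSet {h : G | dist1 h < δ} := measurableSet_lt RegularGaugeGroup.measurable_dist1 measurable_const
  suffices H : ∀ (n : ℕ) (T : Finset (PBond P j)), T.card = n → TreeOrder T v r → (∀ b ∈ T, ∀ y : Site P (j + 1), v b ≠ emb y) →
      ∫⁻ g, ∏ b ∈ T, {h : G | dist1 h < δ}.indicator (1 : G → ℝ≥0∞) (gaugeAct (fineTransf g) U b * (W b)⁻¹)
          ∂Measure.pi (fun _ : FPIdx P j => (HaarData.haar : Measure G)) =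
        (HaarData.haar : Measure G) {h : G | dist1 h < δ} ^ T.card from H _ T rfl hT hv
  intro n
  induction n with
  | zero =>
    intro T hc _ _
    rw [Finset.card_eq_zero] at hc
    subst hc
    simp
  | succ n ih =>
    intro T hcard hT hv
    have hne : T.Nonempty := by rw [← Finset.card_pos, hcard]; exact Nat.succ_pos n
    obtain ⟨b₀, hb₀, hmax⟩ := Finset.exists_max_image T (fun b => r (v b)) hne
    have hfresh := hT.fresh_of_max hb₀ hmax
    have hcard' : (T.erase b₀).card = n := by rw [Finset.card_erase_of_mem hb₀, hcard]; rfl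
    -- the fresh end `x` of `b₀` and its index in the fine gauge group
    have hx : v b₀ ∈ (block (blockOf (v b₀))).erase (emb (blockOf (v b₀))) := mem_erase_of_forall_ne_emb (hv b₀ hb₀)
    set i₀ : FPIdx P j := ⟨blockOf (v b₀), ⟨v b₀, hx⟩⟩ with hi₀
    -- the other bonds do not read the coordinate `i₀`
    have hΦ : ∀ (g : FPIdx P j → G) (k : G),
        (∏ b ∈ T.erase b₀, {h : G | dist1 h < δ}.indicator (1 : G → ℝ≥0∞) (gaugeAct (fineTransf (update g i₀ k)) U b * (W b)⁻¹)) =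
        ∏ b ∈ T.erase b₀, {h : G | dist1 h < δ}.indicator (1 : G → ℝ≥0∞) (gaugeAct (fineTransf g) U b * (W b)⁻¹) := by
      intro g k
      refine Finset.prod_congr rfl fun b hb => ?_
      have hb' := hfresh b hb
      show {h : G | dist1 h < δ}.indicator (1 : G → ℝ≥0∞)
          (fineTransf (update g i₀ k) b.src * U b * (fineTransf (update g i₀ k) b.tgt)⁻¹ * (W b)⁻¹) =
        {h : G | dist1 h < δ}.indicator (1 : G → ℝ≥0∞) (fineTransf g b.src * U b * (fineTransf g b.tgt)⁻¹ * (W b)⁻¹)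
      rw [fineTransf_update_of_ne g i₀ k (z := b.src) hb'.1, fineTransf_update_of_ne g i₀ k (z := b.tgt) hb'.2]
    -- along the coordinate `i₀` the ratio at `b₀` is a (possibly inverted) two-sided translate
    have hψ : ∀ g : FPIdx P j → G,
        (HaarData.haar : Measure G).map (fun k => gaugeAct (fineTransf (update g i₀ k)) U b₀ * (W b₀)⁻¹) = HaarData.haar := by
      intro g
      rcases hT.endpoint b₀ hb₀ with hs | ht
      · have hne : b₀.tgt ≠ (i₀.2 : Site P j) := by
          show b₀.tgt ≠ v b₀; rw [hs]; exact (hT.ne b₀ hb₀).symm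
        have e : (fun k => gaugeAct (fineTransf (update g i₀ k)) U b₀ * (W b₀)⁻¹) =
            fun k => 1 * k * (U b₀ * (fineTransf g b₀.tgt)⁻¹ * (W b₀)⁻¹) := by
          funext k
          show fineTransf (update g i₀ k) b₀.src * U b₀ * (fineTransf (update g i₀ k) b₀.tgt)⁻¹ * (W b₀)⁻¹ = _
          rw [fineTransf_update_of_ne g i₀ k hne, ← hs, fineTransf_update_self g hx k]
          simp only [one_mul, mul_assoc]
        rw [e]; exact haar_map_mul_left_mul_right _ _
      · have hne : b₀.src ≠ (i₀.2 : Site P j) := by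
          show b₀.src ≠ v b₀; rw [ht]; exact hT.ne b₀ hb₀
        have e : (fun k => gaugeAct (fineTransf (update g i₀ k)) U b₀ * (W b₀)⁻¹) =
            fun k => (fineTransf g b₀.src * U b₀) * k⁻¹ * (W b₀)⁻¹ := by
          funext k
          show fineTransf (update g i₀ k) b₀.src * U b₀ * (fineTransf (update g i₀ k) b₀.tgt)⁻¹ * (W b₀)⁻¹ = _
          rw [fineTransf_update_of_ne g i₀ k hne, ← ht, fineTransf_update_self g hx k]
        rw [e]; exact haar_map_mul_inv_mul _ _
    have hΦm : Measurable fun g : FPIdx P j → G =>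
        ∏ b ∈ T.erase b₀, {h : G | dist1 h < δ}.indicator (1 : G → ℝ≥0∞) (gaugeAct (fineTransf g) U b * (W b)⁻¹) :=
      Finset.measurable_prod _ fun b _ => measurable_bondIndicator_fineTransf U W b δ
    have step1 := ih (T.erase b₀) hcard' (hT.mono (Finset.erase_subset b₀ T)) (fun b hb => hv b (Finset.mem_of_mem_erase hb))
    calc ∫⁻ g, ∏ b ∈ T, {h : G | dist1 h < δ}.indicator (1 : G → ℝ≥0∞) (gaugeAct (fineTransf g) U b * (W b)⁻¹)
          ∂Measure.pi (fun _ : FPIdx P j => (HaarData.haar : Measure G))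
        = ∫⁻ g, (∏ b ∈ T.erase b₀, {h : G | dist1 h < δ}.indicator (1 : G → ℝ≥0∞) (gaugeAct (fineTransf g) U b * (W b)⁻¹)) *
            {h : G | dist1 h < δ}.indicator (1 : G → ℝ≥0∞) (gaugeAct (fineTransf g) U b₀ * (W b₀)⁻¹)
            ∂Measure.pi (fun _ : FPIdx P j => (HaarData.haar : Measure G)) := by
          refine lintegral_congr fun g => ?_
          rw [Finset.prod_erase_mul _ _ hb₀]
      _ = (HaarData.haar : Measure G) {h : G | dist1 h < δ} *
            ∫⁻ g, ∏ b ∈ T.erase b₀, {h : G | dist1 h < δ}.indicator (1 : G → ℝ≥0∞) (gaugeAct (fineTransf g) U b * (W b)⁻¹)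
              ∂Measure.pi (fun _ : FPIdx P j => (HaarData.haar : Measure G)) :=
          lintegral_pi_mul_indicator_peel i₀ hΦm hΦ (measurable_bondRatio_fineTransf U W b₀) hψ hS
      _ = (HaarData.haar : Measure G) {h : G | dist1 h < δ} ^ T.card := by
          rw [step1, hcard', hcard, pow_succ']

/-- ★★ **ONE BLOCK COMB: `L^d − 1` FACTORS.**  The comb of the block `B(y)` is a centre-avoiding tree of `L^d − 1` bonds (g28), so
`∫∏dg ∏_{b ∈ comb B(y)} 𝟙{|U^{u_g}(b)·W(b)⁻¹ − 1| < r} = Haar{|h − 1| < r}^{L^d − 1}` for every `U`, `W`, `r`. [cite: Balaban1987RG1, (0.16) p.255 (bookkeeping: the block and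
its non-centre sites)] -/
theorem lintegral_prod_bondIndicator_blockComb_eq_pow (hj : j + 1 ≤ P.m + P.K) (y : Site P (j + 1)) (U : GaugeField P j G)
    (W : PBond P j → G) (δ : ℝ) :
    ∫⁻ g, ∏ b ∈ (combBonds (fun κ => (((y κ).val * P.L : ℕ) : ℤ)) (fun κ => (((y κ).val * P.L + (P.L - 1) : ℕ) : ℤ)) : Finset (PBond P j)),
        {h : G | dist1 h < δ}.indicator (1 : G → ℝ≥0∞) (gaugeAct (fineTransf g) U b * (W b)⁻¹)
        ∂Measure.pi (fun _ : FPIdx P j => (HaarData.haar : Measure G)) =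
      (HaarData.haar : Measure G) {h : G | dist1 h < δ} ^ (P.L ^ P.d - 1) := by
  obtain ⟨v, r, hT, hv⟩ := exists_treeOrder_blockComb_avoiding_emb hj y
  rw [lintegral_prod_bondIndicator_eq_pow hT hv U W δ, card_blockComb hj y]

/-- **THE BLOCK-COMB FOREST OF `Y`: `|Y|·(L^d − 1)` FACTORS.** [cite: Balaban1987RG1, (0.16) p.255 (bookkeeping)] -/
theorem lintegral_prod_bondIndicator_blockCombs_eq_pow (hj : j + 1 ≤ P.m + P.K) (Y : Finset (Site P (j + 1))) (U : GaugeField P j G)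
    (W : PBond P j → G) (δ : ℝ) :
    ∫⁻ g, ∏ b ∈ Y.biUnion (fun y => (combBonds (fun κ => (((y κ).val * P.L : ℕ) : ℤ)) (fun κ => (((y κ).val * P.L + (P.L - 1) : ℕ) : ℤ)) :
          Finset (PBond P j))),
        {h : G | dist1 h < δ}.indicator (1 : G → ℝ≥0∞) (gaugeAct (fineTransf g) U b * (W b)⁻¹)
        ∂Measure.pi (fun _ : FPIdx P j => (HaarData.haar : Measure G)) =
      (HaarData.haar : Measure G) {h : G | dist1 h < δ} ^ (Y.card * (P.L ^ P.d - 1)) := by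
  obtain ⟨v, r, hT, hv⟩ := exists_treeOrder_blockCombs_avoiding_emb hj Y
  rw [lintegral_prod_bondIndicator_eq_pow hT hv U W δ, card_blockCombs hj Y]

end Bonds

/-! ## §3  (3.3)'s `χ′_k(X)` under the uniform fine-gauge orbit average -/

section ChiPrime

open B14.Sect3Decomp

variable {P : Params} {j : ℕ} {G : Type*} [GaugeGroup G]

/-- `0 ≤ χ′_k(X)` (a product of `0∕1` indicators). [cite: Balaban1988Convergent, (3.3) p.265 (bookkeeping)] -/
theorem chiPrime_nonneg (D : Sect3Data P G j) (av : ∀ i, Averaging P i G) (twoδ : ℝ) (X : Finset D.Cube1)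
    (Vk : GaugeField P j G) (V : GaugeField P (j + 1) G) : 0 ≤ chiPrime D av twoδ X Vk V := by
  classical
  unfold chiPrime
  exact Finset.prod_nonneg fun c _ => by split_ifs <;> norm_num

/-- `χ′_k(X) ≤ 1`. [cite: Balaban1988Convergent, (3.3) p.265 (bookkeeping)] -/
theorem chiPrime_le_one (D : Sect3Data P G j) (av : ∀ i, Averaging P i G) (twoδ : ℝ) (X : Finset D.Cube1)
    (Vk : GaugeField P j G) (V : GaugeField P (j + 1) G) : chiPrime D av twoδ X Vk V ≤ 1 := by
  classical
  unfold chiPrime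
  exact Finset.prod_le_one (fun c _ => by split_ifs <;> norm_num) (fun c _ => by split_ifs <;> norm_num)

/-- **`χ′_k(X)` IS DOMINATED BY THE SMALL-RATIO INDICATORS OF ANY BONDS IT READS**: if every bond `b ∈ T` lies in the starred bond set of a cube `c_T(b) ∈ X`, then
`χ′_k(X)(V_k,V) ≤ ∏_{b∈T} 𝟙{|V_k(b)·V^{(k)}_{c_T(b)}(V)(b)⁻¹ − 1| < 2δ}` pointwise (`χ′_k(X) = 1` forces every such ratio small; otherwise `χ′_k(X) = 0`).
[cite: Balaban1988Convergent, (3.3)–(3.4) p.265] -/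
theorem chiPrime_le_toReal_prod_bondIndicator (D : Sect3Data P G j) (av : ∀ i, Averaging P i G) (twoδ : ℝ) (X : Finset D.Cube1)
    (V : GaugeField P (j + 1) G) {T : Finset (PBond P j)} (cT : PBond P j → D.Cube1) (hcX : ∀ b ∈ T, cT b ∈ X)
    (hcb : ∀ b ∈ T, b ∈ D.bondsStar (cT b)) (Vk : GaugeField P j G) :
    chiPrime D av twoδ X Vk V ≤
      (∏ b ∈ T, {h : G | dist1 h < twoδ}.indicator (1 : G → ℝ≥0∞) (Vk b * (Vbox D av (cT b) V b)⁻¹)).toReal := by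
  classical
  by_cases hall : ∀ c ∈ X, SmallApproxFluct D av twoδ Vk V c
  · have h1 : chiPrime D av twoδ X Vk V = 1 := (chiPrime_eq_one_iff D av twoδ X Vk V).2 hall
    have h2 : (∏ b ∈ T, {h : G | dist1 h < twoδ}.indicator (1 : G → ℝ≥0∞) (Vk b * (Vbox D av (cT b) V b)⁻¹)) = 1 :=
      Finset.prod_eq_one fun b hb => by
        rw [Set.indicator_of_mem (show Vk b * (Vbox D av (cT b) V b)⁻¹ ∈ {h : G | dist1 h < twoδ} from hall (cT b) (hcX b hb) b (hcb b hb))]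
        rfl
    rw [h1, h2, ENNReal.toReal_one]
  · push Not at hall
    obtain ⟨c, hc, hnc⟩ := hall
    have h1 : chiPrime D av twoδ X Vk V = 0 := by
      unfold chiPrime
      exact Finset.prod_eq_zero hc (if_neg hnc)
    rw [h1]
    exact ENNReal.toReal_nonneg

/-- The product of small-ratio indicators is at most `1`. [folklore] -/
private theorem prod_bondIndicator_le_one (T : Finset (PBond P j)) (r : ℝ) (R : PBond P j → G) :
    (∏ b ∈ T, {h : G | dist1 h < r}.indicator (1 : G → ℝ≥0∞) (R b)) ≤ 1 :=
  Finset.prod_le_one' fun _ _ => Set.indicator_apply_le' (fun _ => le_rfl) (fun _ => zero_le_one)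

variable [MeasurableSpace G] [HaarData G] [RegularGaugeGroup G] [DecidableEq (PBond P j)]

/-- ★★★ **THE UNIFORM FINE-GAUGE ORBIT AVERAGE OF (3.3)'s SMALL-FIELD FACTOR IS AT MOST `Haar{|h − 1| < 2δ}^{#T}`** — for EVERY fine field `U`, EVERY coarse field `V`, every
(3.3)∕(3.4) datum (any averaging, any background map) and every bond set `T` carrying a centre-avoiding peeling order whose bonds are read by cubes of `X`:
`∫∏_{(y,x)}dg χ′_k(X)(U^{u_g}, V) ≤ (Haar{h : |h − 1| < 2δ})^{#T}`.  This is the weight def-T's (†) gives the ALL-SMALL-FIELD term of (3.3) (g31's orbit-average law): along the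
orbit the background `V^{(k)}_□(V)` stays put while each fresh end of `T` is an independent Haar variable.  In print (3.3) is read after (1.5)⇒(1.6), against the Faddeev–Popov
weight, where `χ′_k` constrains the fluctuation field at mass `≈ 1` ([III] p.265 L.8–12; [I] (0.19)–(0.25)).
[cite: Balaban1988Convergent, (3.3)–(3.4) p.265, (1.5)–(1.6) p.247; Balaban1987RG1, (0.13)–(0.16) pp.254–255, (0.19) p.255] -/
theorem integral_chiPrime_fineOrbit_le_pow (D : Sect3Data P G j) (av : ∀ i, Averaging P i G) (twoδ : ℝ) (X : Finset D.Cube1)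
    (V : GaugeField P (j + 1) G) {T : Finset (PBond P j)} {v : PBond P j → Site P j} {r : Site P j → ℕ} (hT : TreeOrder T v r)
    (hv : ∀ b ∈ T, ∀ y : Site P (j + 1), v b ≠ emb y) (cT : PBond P j → D.Cube1) (hcX : ∀ b ∈ T, cT b ∈ X)
    (hcb : ∀ b ∈ T, b ∈ D.bondsStar (cT b)) (U : GaugeField P j G) :
    ∫ g, chiPrime D av twoδ X (gaugeAct (fineTransf g) U) V ∂Measure.pi (fun _ : FPIdx P j => (HaarData.haar : Measure G)) ≤
      ((HaarData.haar : Measure G) {h : G | dist1 h < twoδ}).toReal ^ T.card := by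
  haveI : IsProbabilityMeasure (HaarData.haar : Measure G) := HaarData.isProb
  set F : (FPIdx P j → G) → ℝ≥0∞ := fun g =>
    ∏ b ∈ T, {h : G | dist1 h < twoδ}.indicator (1 : G → ℝ≥0∞) (gaugeAct (fineTransf g) U b * (Vbox D av (cT b) V b)⁻¹) with hF
  have hFm : Measurable F := Finset.measurable_prod _ fun b _ => measurable_bondIndicator_fineTransf U (fun b => Vbox D av (cT b) V b) b twoδ
  have hFle : ∀ g, F g ≤ 1 := fun g => prod_bondIndicator_le_one T twoδ _
  have hFlt : ∀ g, F g < ∞ := fun g => (hFle g).trans_lt ENNReal.one_lt_top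
  have hFint : Integrable (fun g => (F g).toReal) (Measure.pi (fun _ : FPIdx P j => (HaarData.haar : Measure G))) :=
    (integrable_const (1 : ℝ)).mono' hFm.ennreal_toReal.aestronglyMeasurable (ae_of_all _ fun g => by
      rw [Real.norm_eq_abs, abs_of_nonneg ENNReal.toReal_nonneg]
      exact ENNReal.toReal_le_of_le_ofReal zero_le_one (by rw [ENNReal.ofReal_one]; exact hFle g))
  have hkey : ∫⁻ g, F g ∂Measure.pi (fun _ : FPIdx P j => (HaarData.haar : Measure G)) =
      (HaarData.haar : Measure G) {h : G | dist1 h < twoδ} ^ T.card :=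
    lintegral_prod_bondIndicator_eq_pow hT hv U (fun b => Vbox D av (cT b) V b) twoδ
  calc ∫ g, chiPrime D av twoδ X (gaugeAct (fineTransf g) U) V ∂Measure.pi (fun _ : FPIdx P j => (HaarData.haar : Measure G))
      ≤ ∫ g, (F g).toReal ∂Measure.pi (fun _ : FPIdx P j => (HaarData.haar : Measure G)) :=
        integral_mono_of_nonneg (ae_of_all _ fun g => chiPrime_nonneg D av twoδ X _ V) hFint
          (ae_of_all _ fun g => chiPrime_le_toReal_prod_bondIndicator D av twoδ X V cT hcX hcb _)
    _ = (∫⁻ g, F g ∂Measure.pi (fun _ : FPIdx P j => (HaarData.haar : Measure G))).toReal := integral_toReal hFm.aemeasurable (ae_of_all _ hFlt)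
    _ = ((HaarData.haar : Measure G) {h : G | dist1 h < twoδ}).toReal ^ T.card := by rw [hkey, ENNReal.toReal_pow]

/-- ★★★ **… WITH ANY BOUNDED CO-FACTOR** (the rest of the step weight, `|w̃| ≤ C`, invariant or not): `|∫∏dg χ′_k(X)(U^{u_g},V)·w̃(U^{u_g})| ≤ C·Haar{|h − 1| < 2δ}^{#T}`.
[cite: Balaban1988Convergent, (3.3)–(3.4) p.265, (3.16) p.268; Balaban1987RG1, (0.13)–(0.16) pp.254–255] -/
theorem abs_integral_chiPrime_mul_fineOrbit_le (D : Sect3Data P G j) (av : ∀ i, Averaging P i G) (twoδ : ℝ) (X : Finset D.Cube1)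
    (V : GaugeField P (j + 1) G) {T : Finset (PBond P j)} {v : PBond P j → Site P j} {r : Site P j → ℕ} (hT : TreeOrder T v r)
    (hv : ∀ b ∈ T, ∀ y : Site P (j + 1), v b ≠ emb y) (cT : PBond P j → D.Cube1) (hcX : ∀ b ∈ T, cT b ∈ X)
    (hcb : ∀ b ∈ T, b ∈ D.bondsStar (cT b)) {w : GaugeField P j G → ℝ} {C : ℝ} (hw : ∀ Vk, |w Vk| ≤ C) (U : GaugeField P j G) :
    |∫ g, chiPrime D av twoδ X (gaugeAct (fineTransf g) U) V * w (gaugeAct (fineTransf g) U)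
        ∂Measure.pi (fun _ : FPIdx P j => (HaarData.haar : Measure G))| ≤
      C * ((HaarData.haar : Measure G) {h : G | dist1 h < twoδ}).toReal ^ T.card := by
  haveI : IsProbabilityMeasure (HaarData.haar : Measure G) := HaarData.isProb
  have hC : 0 ≤ C := (abs_nonneg _).trans (hw 1)
  set F : (FPIdx P j → G) → ℝ≥0∞ := fun g =>
    ∏ b ∈ T, {h : G | dist1 h < twoδ}.indicator (1 : G → ℝ≥0∞) (gaugeAct (fineTransf g) U b * (Vbox D av (cT b) V b)⁻¹) with hF
  have hFm : Measurable F := Finset.measurable_prod _ fun b _ => measurable_bondIndicator_fineTransf U (fun b => Vbox D av (cT b) V b) b twoδ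
  have hFle : ∀ g, F g ≤ 1 := fun g => prod_bondIndicator_le_one T twoδ _
  have hFlt : ∀ g, F g < ∞ := fun g => (hFle g).trans_lt ENNReal.one_lt_top
  have hFint : Integrable (fun g => (F g).toReal) (Measure.pi (fun _ : FPIdx P j => (HaarData.haar : Measure G))) :=
    (integrable_const (1 : ℝ)).mono' hFm.ennreal_toReal.aestronglyMeasurable (ae_of_all _ fun g => by
      rw [Real.norm_eq_abs, abs_of_nonneg ENNReal.toReal_nonneg]
      exact ENNReal.toReal_le_of_le_ofReal zero_le_one (by rw [ENNReal.ofReal_one]; exact hFle g))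
  have hkey : ∫⁻ g, F g ∂Measure.pi (fun _ : FPIdx P j => (HaarData.haar : Measure G)) =
      (HaarData.haar : Measure G) {h : G | dist1 h < twoδ} ^ T.card :=
    lintegral_prod_bondIndicator_eq_pow hT hv U (fun b => Vbox D av (cT b) V b) twoδ
  have hpt : ∀ g : FPIdx P j → G,
      |chiPrime D av twoδ X (gaugeAct (fineTransf g) U) V * w (gaugeAct (fineTransf g) U)| ≤ C * (F g).toReal := by
    intro g
    rw [abs_mul, abs_of_nonneg (chiPrime_nonneg D av twoδ X _ V), mul_comm]
    exact mul_le_mul (hw _) (chiPrime_le_toReal_prod_bondIndicator D av twoδ X V cT hcX hcb _) (chiPrime_nonneg D av twoδ X _ V) hC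
  calc |∫ g, chiPrime D av twoδ X (gaugeAct (fineTransf g) U) V * w (gaugeAct (fineTransf g) U)
          ∂Measure.pi (fun _ : FPIdx P j => (HaarData.haar : Measure G))|
      ≤ ∫ g, |chiPrime D av twoδ X (gaugeAct (fineTransf g) U) V * w (gaugeAct (fineTransf g) U)|
          ∂Measure.pi (fun _ : FPIdx P j => (HaarData.haar : Measure G)) := abs_integral_le_integral_abs
    _ ≤ ∫ g, C * (F g).toReal ∂Measure.pi (fun _ : FPIdx P j => (HaarData.haar : Measure G)) :=
        integral_mono_of_nonneg (ae_of_all _ fun g => abs_nonneg _) (hFint.const_mul C) (ae_of_all _ hpt)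
    _ = C * ((HaarData.haar : Measure G) {h : G | dist1 h < twoδ}).toReal ^ T.card := by
        rw [integral_const_mul, integral_toReal hFm.aemeasurable (ae_of_all _ hFlt), hkey, ENNReal.toReal_pow]

/-- ★★★ **ONE BLOCK COMB INSIDE A CUBE OF `X`: `[χ′_k(X)]^{av} ≤ Haar{|h − 1| < 2δ}^{L^d − 1}`** — if the starred bond set of some cube `c ∈ X` contains the comb of a block `B(y)`
(print: `(□′^{∼2})^{(k)*} ⊇` every bond of every block inside `□′^{∼2}`), the uniform orbit average of `χ′_k(X)` is at most the `(L^d − 1)`-st power of the Haar volume of the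
`2δ`-ball, at every `(U, V)`. [cite: Balaban1988Convergent, (3.3)–(3.4) p.265; Balaban1987RG1, (0.16) p.255] -/
theorem integral_chiPrime_fineOrbit_le_pow_blockComb (hj : j + 1 ≤ P.m + P.K) (D : Sect3Data P G j) (av : ∀ i, Averaging P i G) (twoδ : ℝ)
    (X : Finset D.Cube1) (V : GaugeField P (j + 1) G) {c : D.Cube1} (hc : c ∈ X) (y : Site P (j + 1))
    (hcomb : ∀ b ∈ (combBonds (fun κ => (((y κ).val * P.L : ℕ) : ℤ)) (fun κ => (((y κ).val * P.L + (P.L - 1) : ℕ) : ℤ)) : Finset (PBond P j)),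
      b ∈ D.bondsStar c) (U : GaugeField P j G) :
    ∫ g, chiPrime D av twoδ X (gaugeAct (fineTransf g) U) V ∂Measure.pi (fun _ : FPIdx P j => (HaarData.haar : Measure G)) ≤
      ((HaarData.haar : Measure G) {h : G | dist1 h < twoδ}).toReal ^ (P.L ^ P.d - 1) := by
  obtain ⟨v, r, hT, hv⟩ := exists_treeOrder_blockComb_avoiding_emb hj y
  rw [← card_blockComb (P := P) (j := j) hj y]
  exact integral_chiPrime_fineOrbit_le_pow D av twoδ X V hT hv (fun _ => c) (fun _ _ => hc) hcomb U

end ChiPrime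

end Summit.QuantumFields.YangMills.Theorems.BalabanUVNodesN11ChiPrimeFineOrbitAverageBound

end
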